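/-
Copyright (c) 2026. All rights reserved.
Released under Apache 2.0 license as described in the file LICENSE.
Authors: abc-iut cell, prover seat abc-iut-L4-d2 (gen 9).
-/
import Literature.AnabelianGeometry.AbsoluteAnabelian.GaloisTheatersNumberFieldShadowAutRel
import Literature.AnabelianGeometry.AbsoluteAnabelian.GaloisTheatersNumberFieldShadowPanalocal
import HarnessLib

/-!
# [AbsTopIII] Rmk 5.1.1 at the number-field shadow, explicit form: a morphism of global Galois-theaters acts on local
# elements by `V⊚(φ_Π)` read through the reference isomorphisms

S. Mochizuki, *Topics in absolute anabelian geometry III* [MochizukiAbsTopIII2015], Rmk 5.1.1 p. 118 (gloss: the reference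
isomorphism `ψ_V` and, in a morphism of global Galois-theaters, `φ_V` are uniquely determined — nonarchimedean elements by any
open subgroup of their decomposition groups, archimedean elements by the topology `κ_v` induces on `k_NF(Π)`), Def 5.1 (iii)
pp. 115–116.

The cell proved Rmk 5.1.1 at `NumberFieldShadow.context F` as the two uniqueness facts `referenceIsoUnique_context` /
`theaterHomDeterminedByGroupHom_context` (abc-iut-L4-d2 g6, `GaloisTheatersNumberFieldShadowRmk511.lean`).  For the
panalocalization of morphisms of `T`-pairs (F-3086, sequel) the EXPLICIT form is needed: for a morphism `φ : V⊚₁ → V⊚₂` of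
global Galois-theaters over the shadow and reference isomorphisms `ψ_{V,1}`, `ψ_{V,2}`,
`φ_V(ψ_{V,1}(ṽ)) = ψ_{V,2}(V⊚(φ_Π)(ṽ))` for every `ṽ ∈ V⊚(Π₁)` — i.e. `ψ_{V,2}⁻¹ ∘ φ_V ∘ ψ_{V,1} = V⊚(φ_Π) = (τ_{φ_Π} ·)`.
THIS PROOF-ONLY FILE proves it by print's argument: at `⊚` by (a); at nonarchimedean `ṽ` both sides have decomposition
groups containing `φ_Π(Π_{1,ṽ}) = φ_Π(Π₁) ∩ Π_{2,V⊚(φ_Π)ṽ}`, an open subgroup of a decomposition group, which pins the element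
([NSW 12.1.3] at the shadow: `context_hnon_open`); at archimedean `ṽ` both induce on `k_NF(Π₂) = ℚ̄` — after composing with
`k_NF(φ_Π) = (τ ·)` — the topology of `κ_{ell,ṽ}` (`context_harc`), the embeddings under `ṽ` and `τ • ṽ` differing by a
HOMEOMORPHIC field automorphism of `ℂ` (`exists_ringEquiv_isHomeomorph_contextKappa_smul`, identity or conjugation).

* `exists_ringEquiv_isHomeomorph_contextKappa_smul` — as `exists_ringEquiv_contextKappa_smul` (AutRel file), recording that
  `C` is a homeomorphism;
* **`theaterHom_phiV_apply_eq`** — the displayed formula.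

HONEST LABEL: ARITHMETIC SHADOW (`Δ = 1`, stub archimedean orbispaces with genuine `κ_{ell,v}`), NOT print's `EA⊚` (E-L4-13).
No `def`/`instance`/`structure`; nothing here bears on [IUTchIII] Cor. 3.12 or takes a side; typed ≠ proved.
-/

noncomputable section

open scoped Pointwise Topology
open CategoryTheory NumberField Field TopologicalSpace

namespace Literature.AnabelianGeometry.AbsoluteAnabelian

namespace NumberFieldShadow

variable (F : Type) [Field F] [NumberField F]

/-! ### The embeddings under `v` and `τ • v`: the comparison automorphism of `ℂ` is a homeomorphism -/

/-- **The complex embeddings chosen under an archimedean `v` and under `w = τ • v` correspond under `τ` up to a BICONTINUOUS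
field automorphism of `ℂ`** (the identity or complex conjugation): `κ_w(τ · x) = C(κ_v(x))`.
[cite: MochizukiAbsTopIII2015, Def 5.1 (i) p.113] -/
theorem exists_ringEquiv_isHomeomorph_contextKappa_smul {E₁ E₂ : FundamentalExtension.{0}} (τ : absoluteGaloisGroup ℚ)
    (v : (contextProVal E₁).arc) (w' : (contextProVal E₂).arc)
    (hvw : (w'.1 : (NumberField.valuationProSet ℚ).carrier) =
      (letI := (NumberField.valuationProSet ℚ).action; τ • (show (NumberField.valuationProSet ℚ).carrier from v.1))) :
    ∃ C : ℂ ≃+* ℂ, IsHomeomorph C ∧ ∀ x : AlgebraicClosure ℚ, contextKappa E₂ w' (τ • x) = C (contextKappa E₁ v x) := by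
  letI := NumberFieldValuationProSet.archAction ℚ
  obtain ⟨w', hv⟩ := w'
  change w' = _ at hvw
  subst hvw
  let w : InfinitePlace (AlgebraicClosure ℚ) := contextArcPlace E₁ v
  have hw₂ : contextArcPlace E₂ ⟨_, hv⟩ = τ • w := contextArcPlace_smul τ v hv
  let τA : AlgebraicClosure ℚ ≃ₐ[ℚ] AlgebraicClosure ℚ := absoluteGaloisGroup.toAlgEquiv ℚ τ
  have hmk : InfinitePlace.mk (τ • w).embedding =
      InfinitePlace.mk (w.embedding.comp (τA.symm : AlgebraicClosure ℚ →+* AlgebraicClosure ℚ)) := by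
    rw [InfinitePlace.mk_embedding, ← InfinitePlace.smul_mk, InfinitePlace.mk_embedding]
    rfl
  have hκ₂ : ∀ x : AlgebraicClosure ℚ, contextKappa E₂ ⟨_, hv⟩ (τ • x) = (τ • w).embedding (τA x) := by
    intro x
    change (contextArcPlace E₂ ⟨_, hv⟩).embedding (τA x) = _
    rw [hw₂]
  have hκ₁ : ∀ x : AlgebraicClosure ℚ, w.embedding x = contextKappa E₁ v x := fun _ => rfl
  have hsymm : ∀ x : AlgebraicClosure ℚ,
      ((τA.symm : AlgebraicClosure ℚ →+* AlgebraicClosure ℚ) (τA x)) = x := fun x => τA.symm_apply_apply x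
  have hconj : IsHomeomorph (fun z : ℂ => Complex.conjAe.toRingEquiv z) :=
    (Homeomorph.mk ⟨fun z : ℂ => Complex.conjAe.toRingEquiv z, fun z => Complex.conjAe.toRingEquiv z,
      fun z => by simp [Complex.conjAe_coe], fun z => by simp [Complex.conjAe_coe]⟩
      (by simpa [Complex.conjAe_coe] using Complex.continuous_conj)
      (by simpa [Complex.conjAe_coe] using Complex.continuous_conj)).isHomeomorph
  rcases InfinitePlace.mk_eq_iff.mp hmk with hφ | hφ
  · refine ⟨RingEquiv.refl ℂ, (Homeomorph.refl ℂ).isHomeomorph, fun x => ?_⟩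
    rw [hκ₂]
    have hx := congrArg (fun φ : AlgebraicClosure ℚ →+* ℂ => φ (τA x)) hφ
    simp only [RingHom.coe_comp, Function.comp_apply] at hx
    rw [hsymm, hκ₁] at hx
    exact hx
  · refine ⟨Complex.conjAe.toRingEquiv, hconj, fun x => ?_⟩
    rw [hκ₂]
    have hx := congrArg (fun φ : AlgebraicClosure ℚ →+* ℂ => φ (τA x)) hφ
    simp only [RingHom.coe_comp, Function.comp_apply] at hx
    rw [hsymm, ComplexEmbedding.conjugate_coe_eq] at hx
    have hx' := congrArg (starRingEnd ℂ) hx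
    rw [Complex.conj_conj, hκ₁] at hx'
    rw [hx']
    simp [Complex.conjAe_coe]

/-! ### `φ_V ∘ ψ_{V,1} = ψ_{V,2} ∘ V⊚(φ_Π)` -/

/-- **Rmk 5.1.1 at the shadow, explicit form**: for a morphism `φ` of global Galois-theaters over `NumberFieldShadow.context F`
and reference isomorphisms `ψ_{V,1}`, `ψ_{V,2}` of source and target, `φ_V(ψ_{V,1}(ṽ)) = ψ_{V,2}(V⊚(φ_Π)(ṽ))` for every
`ṽ ∈ V⊚(Π₁)`: at `⊚` by condition (a); at nonarchimedean `ṽ` because both sides have decomposition groups containing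
`φ_Π(Π₁) ∩ Π_{2,V⊚(φ_Π)(ṽ)} = φ_Π(Π_{1,ṽ})`, an open subgroup of a decomposition group ([NSW 12.1.3], `context_hnon_open`); at
archimedean `ṽ` because both induce on `k_NF(Π₂)`, through `k_NF(φ_Π)`, the topology of `κ_{ell,ṽ}` (`context_harc`).
[cite: MochizukiAbsTopIII2015, Rmk 5.1.1 p.118] -/
theorem theaterHom_phiV_apply_eq {T₁ T₂ : GlobalGaloisTheater (context F)} (φ : GlobalGaloisTheater.Hom T₁ T₂)
    (ψV₁ : ((context F).proVal T₁.ext).carrier ≃ₜ T₁.V.carrier) (hψV₁ : T₁.IsReferenceIso ψV₁)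
    (ψV₂ : ((context F).proVal T₂.ext).carrier ≃ₜ T₂.V.carrier) (hψV₂ : T₂.IsReferenceIso ψV₂)
    (v : ((context F).proVal T₁.ext).carrier) :
    φ.φV (ψV₁ v) = ψV₂ ((context F).mapProVal φ.φgrp φ.isEAHom v) := by
  letI := (NumberField.valuationProSet ℚ).action
  have h₁ : IsAdmissible F T₁.ext := T₁.isAdmissible
  have h₂ : IsAdmissible F T₂.ext := T₂.isAdmissible
  -- `u := ψ_{V,2}⁻¹(φ_V(ψ_{V,1}(v)))`; we show `u = V⊚(φ_Π)(v)`
  rw [← ψV₂.apply_symm_apply (φ.φV (ψV₁ v))]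
  congr 1
  set u := ψV₂.symm (φ.φV (ψV₁ v)) with hu
  have hψu : ψV₂ u = φ.φV (ψV₁ v) := ψV₂.apply_symm_apply _
  rcases ((context F).proVal T₁.ext).eq_generic_or_mem v with hv | hv | hv
  · -- the generic element
    subst hv
    have hgen₂ : φ.φV (ψV₁ ((context F).proVal T₁.ext).generic) = ψV₂ ((context F).proVal T₂.ext).generic := by
      rw [hψV₁.2.1, φ.φV_generic, hψV₂.2.1]
    change u = contextMapProVal φ.φgrp φ.isEAHom (contextProVal T₁.ext).generic
    rw [contextMapProVal_generic]
    exact ψV₂.injective (hψu.trans hgen₂)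
  · -- nonarchimedean elements
    have hv₁ : ψV₁ v ∈ T₁.V.non := by rw [← hψV₁.2.2.1]; exact ⟨v, hv, rfl⟩
    have hv₂ : φ.φV (ψV₁ v) ∈ T₂.V.non := by rw [← φ.image_non]; exact ⟨_, hv₁, rfl⟩
    have hun : u ∈ ((context F).proVal T₂.ext).non := by
      have h : φ.φV (ψV₁ v) ∈ ψV₂ '' ((context F).proVal T₂.ext).non := by rw [hψV₂.2.2.1]; exact hv₂
      obtain ⟨u', hu', he⟩ := h
      rwa [← ψV₂.injective (he.trans hψu.symm)]
    have hwn : (context F).mapProVal φ.φgrp φ.isEAHom v ∈ ((context F).proVal T₂.ext).non :=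
      contextMapProVal_mem_non φ.φgrp φ.isEAHom v hv
    symm
    refine context_hnon_open F T₂.ext h₂ _ _ hwn hun (φ.φgrp.arith.toMonoidHom.range) φ.isEAHom.isOpen_range ?_
    rintro x ⟨⟨g, rfl⟩, hx⟩
    have hg : g ∈ ((context F).proVal T₁.ext).decomp v :=
      (GlobalAnabelianContext.mem_decomp_mapProVal_iff φ.φgrp φ.isEAHom v g).mp hx
    have hg' : g ∈ T₁.V.decomp (ψV₁ v) := by rw [hψV₁.decomp_apply]; exact hg
    have hφg : φ.φgrp.arith g ∈ T₂.V.decomp (φ.φV (ψV₁ v)) := φ.map_decomp_le (ψV₁ v) ⟨g, hg', rfl⟩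
    change φ.φgrp.arith g ∈ ((context F).proVal T₂.ext).decomp u
    rw [← hψV₂.decomp_apply u, hψu]
    exact hφg
  · -- archimedean elements: compare the topologies induced on `ℚ̄` through `k_NF(φ_Π) = (τ ·)`
    have hv₁ : ψV₁ v ∈ T₁.V.arc := by rw [← hψV₁.2.2.2.1]; exact ⟨v, hv, rfl⟩
    have hv₂ : φ.φV (ψV₁ v) ∈ T₂.V.arc := by rw [← φ.image_arc]; exact ⟨_, hv₁, rfl⟩
    have hua : u ∈ ((context F).proVal T₂.ext).arc := by
      have h : φ.φV (ψV₁ v) ∈ ψV₂ '' ((context F).proVal T₂.ext).arc := by rw [hψV₂.2.2.2.1]; exact hv₂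
      obtain ⟨u', hu', he⟩ := h
      rwa [← ψV₂.injective (he.trans hψu.symm)]
    have hwa : (context F).mapProVal φ.φgrp φ.isEAHom v ∈ ((context F).proVal T₂.ext).arc :=
      contextMapProVal_mem_arc φ.φgrp φ.isEAHom v hv
    let τ : absoluteGaloisGroup ℚ := conjugator φ.φgrp φ.isEAHom
    -- plain-typed names: `m = k_NF(φ_Π)`, the embeddings, the topologies
    let m : AlgebraicClosure ℚ → AlgebraicClosure ℚ := fun x => contextMapKNF φ.φgrp φ.isEAHom x
    let κa : AlgebraicClosure ℚ → (T₁.X ⟨ψV₁ v, hv₁⟩).fieldA := fun x => T₁.κ ⟨ψV₁ v, hv₁⟩ x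
    let κb : AlgebraicClosure ℚ → (T₂.X ⟨φ.φV (ψV₁ v), hv₂⟩).fieldA := fun x => T₂.κ ⟨φ.φV (ψV₁ v), hv₂⟩ x
    let κv : AlgebraicClosure ℚ → ℂ := fun x => contextKappa T₁.ext ⟨v, hv⟩ x
    let κu : AlgebraicClosure ℚ → ℂ := fun x => contextKappa T₂.ext ⟨u, hua⟩ x
    let κw : AlgebraicClosure ℚ → ℂ := fun x => contextKappa T₂.ext ⟨_, hwa⟩ x
    let tℂ : TopologicalSpace ℂ := inferInstance
    let t₀ : TopologicalSpace (AlgebraicClosure ℚ) := induced κv tℂ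
    -- (1) through `u`: `κ_{φ_V(ψ v)} ∘ k_NF(φ_Π)` induces `t₀`
    obtain ⟨φv, hφv, -, hκφ⟩ := φ.arch_compat ⟨ψV₁ v, hv₁⟩ hv₂
    have e₁ : induced κa (T₁.X ⟨ψV₁ v, hv₁⟩).topA = t₀ := hψV₁.induced_eq ⟨v, hv⟩ ⟨ψV₁ v, hv₁⟩ rfl
    have e₂ : induced κb (T₂.X ⟨φ.φV (ψV₁ v), hv₂⟩).topA = induced κu tℂ :=
      hψV₂.induced_eq ⟨u, hua⟩ ⟨φ.φV (ψV₁ v), hv₂⟩ hψu.symm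
    have hind : (T₁.X ⟨ψV₁ v, hv₁⟩).topA = induced φv.fieldIso (T₂.X ⟨φ.φV (ψV₁ v), hv₂⟩).topA :=
      (hφv.homeomorph _).isInducing.eq_induced
    have hfun₁ : κb ∘ m = φv.fieldIso ∘ κa := funext fun x => hκφ x
    have hu_ind : induced m (induced κu tℂ) = t₀ := by
      rw [← e₂, induced_compose, hfun₁, ← induced_compose, ← hind, e₁]
    -- (2) through `w := V⊚(φ_Π)(v) = τ • v`: `κ_{ell,w} ∘ k_NF(φ_Π) = C ∘ κ_{ell,v}` induces `t₀`
    have hτw : ((⟨_, hwa⟩ : (contextProVal T₂.ext).arc).1 : (NumberField.valuationProSet ℚ).carrier) =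
        τ • (show (NumberField.valuationProSet ℚ).carrier from v) := context_mapProVal_apply F φ.φgrp φ.isEAHom v
    obtain ⟨C, hC, hCκ⟩ := exists_ringEquiv_isHomeomorph_contextKappa_smul (E₁ := T₁.ext) (E₂ := T₂.ext) τ ⟨v, hv⟩
      ⟨_, hwa⟩ hτw
    have hCind : induced (fun z : ℂ => C z) tℂ = tℂ := (hC.homeomorph _).induced_eq
    have hfun₂ : κw ∘ m = (fun z : ℂ => C z) ∘ κv := funext fun x => hCκ x
    have hw_ind : induced m (induced κw tℂ) = t₀ := by
      rw [induced_compose, hfun₂, ← induced_compose, hCind]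
    -- (3) cancel the bijection `k_NF(φ_Π)` and conclude by (arc)-separation
    have hcancel : ∀ t t' : TopologicalSpace (AlgebraicClosure ℚ), induced m t = induced m t' → t = t' := by
      intro t t' h
      have h' := congrArg (fun s => induced (fun x => (contextMapKNF φ.φgrp φ.isEAHom).symm x) s) h
      simp only [induced_compose] at h'
      have hid : m ∘ (fun x => (contextMapKNF φ.φgrp φ.isEAHom).symm x) = id :=
        funext fun x => RingEquiv.apply_symm_apply _ x
      rw [hid, @induced_id _ t, @induced_id _ t'] at h'
      exact h'
    have huw : (⟨u, hua⟩ : ((context F).proVal T₂.ext).arc) = ⟨_, hwa⟩ :=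
      context_harc F T₂.ext h₂ _ _ (hcancel _ _ (hu_ind.trans hw_ind.symm))
    exact congrArg Subtype.val huw

end NumberFieldShadow

end Literature.AnabelianGeometry.AbsoluteAnabelian

end
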